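import Literature.AlgebraicGeometry.Morphisms.FormalFunctionsModuleCokernel
import Summits.ResolutionOfSingularities.ResolutionOfSingularities.Theorems.HomologicalConductorNoZenoFullSheafHomEquiv
import Summits.ResolutionOfSingularities.ResolutionOfSingularities.Theorems.HomologicalConductorNoZenoFullSheafFree
import HarnessLib

/-!
# Crux `NoZenoR` / `NoZeno` (stmt-ResolutionOfSingularities-19943 / -16483), line `sandwich-cluster`,
# G-layer, G2 (A5 device): the presentation of `M~` by generators FACTORS as
# `𝒪_X^n ≅ (T^n)~ ⟶ M~` through the full sheaf of `T^n ↠ M`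

OURS (cell res-hironaka, chain W4.4, res-L0-w44-stub-4 for the G2 holder res-D-pv-045 AS
res-L0-w44-stub-8: holder's A5 plan, STATUS 07:03:18Z «q~ := sheafHomOf (q_M : T^n ↠ M); an endomorphism
of M~ factors through q~ iff the module endomorphism factors through q_M»). Nothing here is a statement
of the manuscript under review (Hironaka 2017) and nothing of `[claim: Hironaka2017]` is used;
AI-written, weaker than expert review.

Conventions of `…FullSheafHomEquiv` (`T` a domain, `[Algebra T K(X)] [IsFractionRing T K(X)]` instance
arguments, `T`-LINEAR embeddings). The free module `T^n` is embedded into `K(X)^n` by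
`piBaseLinear n := (Algebra.linearMap T K(X)).compLeft (Fin n)` (componentwise `algebraMap`):

* `piBaseLinear_apply`, `piBaseLinear_injective`, `span_range_piBaseLinear_eq_top` — the hypotheses
  `hφinj`, `hspan` of `sheafHomOf` / `sheafHomEquiv` for the source `T^n`;
* `isIso_presentation_piBaseLinear` — `𝒪_X^n ⟶ (T^n)~` (pv-024's `presentation` by the standard basis)
  is an isomorphism (instance of `isIso_presentation_of_componentwise`, p509700);
* **`presentation_eq_presentation_piBaseLinear_comp_sheafHomOf`** — for generators-or-not
  `m : Fin n → M` of a module `M` embedded by `φ : M →ₗ[T] V`, pv-024's presentation of `M~` attached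
  to the `φ (m k)` EQUALS the composite `𝒪_X^n ⟶ (T^n)~ ⟶ M~` of the basis presentation of `(T^n)~`
  with `sheafHomOf (Fintype.linearCombination T m)`, the morphism of full sheaves induced by
  `q_M : T^n → M`, `e_k ↦ m_k` (both send the basis section `e_k` to `σ_{φ(m_k)}`; morphisms out of a
  free module are determined by the images of the basis, tree `free_hom_ext`).

Everything is proved; no named facts. [this work]
-/

-- single-problem summit: the doubled namespace component `ResolutionOfSingularities` is forced
set_option linter.dupNamespace false

noncomputable section

universe u

open CategoryTheory CategoryTheory.Limits AlgebraicGeometry TopologicalSpace Opposite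
open Literature.AlgebraicGeometry.Resolution Literature.AlgebraicGeometry.Morphisms
open Literature.AlgebraicGeometry.Modules

namespace Summit.ResolutionOfSingularities.ResolutionOfSingularities.Theorems.NoZeno.SandwichCluster.FullSheaf

variable {X : Scheme.{u}} [IsIntegral X]
variable {T : Type u} [CommRing T] [Algebra T X.functionField]

/-! ## The linear embedding `T^n ↪ K(X)^n` -/

/-- Pointwise: `piBaseLinear` is componentwise `algebraMap T K(X)`. [this work] -/
theorem piBaseLinear_apply (n : ℕ) (v : Fin n → T) (i : Fin n) :
    ((Algebra.linearMap T X.functionField).compLeft (Fin n)) v i = algebraMap T X.functionField (v i) :=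
  rfl

/-- The componentwise embedding `T^n → K(X)^n` is injective (`K(X) = Frac T`). [this work] -/
theorem piBaseLinear_injective [IsFractionRing T X.functionField] (n : ℕ) :
    Function.Injective ((Algebra.linearMap T X.functionField).compLeft (Fin n)) := fun _ _ h =>
  funext fun i => IsFractionRing.injective T X.functionField (congrFun h i)

/-- The image of `T^n` spans `K(X)^n` over `K(X)` (it contains the standard basis). [this work] -/
theorem span_range_piBaseLinear_eq_top (n : ℕ) :
    Submodule.span X.functionField
      (Set.range ((Algebra.linearMap T X.functionField).compLeft (Fin n))) = ⊤ := by
  refine eq_top_iff.mpr ?_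
  rw [← (Pi.basisFun X.functionField (Fin n)).span_eq]
  refine Submodule.span_le.mpr ?_
  rintro _ ⟨k, rfl⟩
  refine Submodule.subset_span ⟨Pi.single k 1, ?_⟩
  rw [Pi.basisFun_apply]
  funext i
  rw [LinearMap.compLeft_apply, Function.comp_apply, Pi.single_apply, Pi.single_apply]
  split_ifs <;> simp

/-- `𝒪_X^n ⟶ (T^n)~` (pv-024's presentation by the standard basis, `T^n` embedded by `piBaseLinear`) is
an isomorphism, whenever the `T`-algebra structure of `K(X)` is the one of a structure map
`π : X → Spec T` (`halg`; `fun _ => rfl` under `letI := (baseToFunctionField π).toAlgebra`). [this work] -/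
theorem isIso_presentation_piBaseLinear (π : X ⟶ Spec (.of T))
    (halg : ∀ a : T, algebraMap T X.functionField a = baseToFunctionField π a) (n : ℕ) :
    IsIso (presentation (X := X) (Fin n → X.functionField)
      (Set.range ((Algebra.linearMap T X.functionField).compLeft (Fin n)))
      (fun k => ⟨((Algebra.linearMap T X.functionField).compLeft (Fin n)) (Pi.single k 1),
        Pi.single k 1, rfl⟩)) :=
  isIso_presentation_of_componentwise π
    ((Algebra.linearMap T X.functionField).compLeft (Fin n)).toAddMonoidHom fun v i => halg (v i)

/-! ## The presentation of `M~` factors through `(T^n)~` -/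

/-- `ofMem` only depends on the value (proof-irrelevant transport along an equality of values).
[folklore] -/
theorem ofMem_congr {W : Type u} [AddCommGroup W] [Module X.functionField W] (S : Set W) (U : X.Opens)
    {v v' : W} (h : v = v') (hv : v ∈ S) (hv' : v' ∈ S) : ofMem W S U v hv = ofMem W S U v' hv' := by
  subst h
  rfl

section Factor

variable [IsDomain T] [IsFractionRing T X.functionField]
variable {V : Type u} [AddCommGroup V] [Module X.functionField V] [Module T V]
  [IsScalarTower T X.functionField V]
variable {M : Type*} [AddCommGroup M] [Module T M] (φ : M →ₗ[T] V)

/-- **The presentation of `M~` by `m_1, …, m_n` factors as `𝒪_X^n ⟶ (T^n)~ ⟶ M~`**: pv-024's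
`presentation` attached to the sections `σ_{φ(m_k)}` equals the basis presentation of the full sheaf of
`T^n` followed by `sheafHomOf (Fintype.linearCombination T m)`, the morphism of full sheaves induced by
`q_M : T^n → M`, `e_k ↦ m_k` (`…FullSheafHomEquiv`). Both send the basis section `e_k` of `𝒪_X^n` to
`σ_{φ(m_k)}`. [this work] -/
theorem presentation_eq_presentation_piBaseLinear_comp_sheafHomOf {n : ℕ} (m : Fin n → M) :
    presentation (X := X) V (Set.range φ) (fun k => ⟨φ (m k), m k, rfl⟩) =
      presentation (X := X) (Fin n → X.functionField)
          (Set.range ((Algebra.linearMap T X.functionField).compLeft (Fin n)))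
          (fun k => ⟨((Algebra.linearMap T X.functionField).compLeft (Fin n)) (Pi.single k 1),
            Pi.single k 1, rfl⟩) ≫
        sheafHomOf ((Algebra.linearMap T X.functionField).compLeft (Fin n)) φ
          (piBaseLinear_injective n) (span_range_piBaseLinear_eq_top n)
          (Fintype.linearCombination T m) := by
  classical
  refine Literature.AlgebraicGeometry.Morphisms.free_hom_ext fun i => ?_
  obtain ⟨i⟩ := i
  rw [SheafOfModules.freeHomEquiv_apply, SheafOfModules.freeHomEquiv_apply,
    sectionsEquivTop_sectionsMap, sectionsEquivTop_sectionsMap]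
  change (presentation (X := X) V (Set.range φ) (fun k => ⟨φ (m k), m k, rfl⟩)).app ⊤
      ((SheafOfModules.freeSection (R := X.ringCatSheaf) (ULift.up i)).val (op ⊤)) =
    (sheafHomOf ((Algebra.linearMap T X.functionField).compLeft (Fin n)) φ
        (piBaseLinear_injective n) (span_range_piBaseLinear_eq_top n)
        (Fintype.linearCombination T m)).app ⊤
      ((presentation (X := X) (Fin n → X.functionField)
          (Set.range ((Algebra.linearMap T X.functionField).compLeft (Fin n)))
          (fun k => ⟨((Algebra.linearMap T X.functionField).compLeft (Fin n)) (Pi.single k 1),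
            Pi.single k 1, rfl⟩)).app ⊤
        ((SheafOfModules.freeSection (R := X.ringCatSheaf) (ULift.up i)).val (op ⊤)))
  rw [presentation_app_freeSection, presentation_app_freeSection]
  change ofMem V (Set.range φ) ⊤ (φ (m i)) ⟨m i, rfl⟩ =
    (sheafHomOf ((Algebra.linearMap T X.functionField).compLeft (Fin n)) φ
        (piBaseLinear_injective n) (span_range_piBaseLinear_eq_top n)
        (Fintype.linearCombination T m)).app ⊤
      (ofMem (Fin n → X.functionField)
        (Set.range ((Algebra.linearMap T X.functionField).compLeft (Fin n))) ⊤
        (((Algebra.linearMap T X.functionField).compLeft (Fin n)) (Pi.single i 1)) ⟨Pi.single i 1, rfl⟩)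
  rw [sheafHomOf_app_ofMem]
  exact ofMem_congr (Set.range φ) ⊤
    (by rw [Fintype.linearCombination_apply_single, one_smul]) _ _

end Factor

end Summit.ResolutionOfSingularities.ResolutionOfSingularities.Theorems.NoZeno.SandwichCluster.FullSheaf

end
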